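import Literature.AnabelianGeometry.SemiGraphs.SgATemperedArrows
import Literature.AnabelianGeometry.SemiGraphs.CoveringGraphPointLift
import Literature.AnabelianGeometry.SemiGraphs.OrbitGraph
import HarnessLib

/-!
# [SemiAnbd] Def. 3.5 (i)/(ii): a morphism of profinite presentations read as an isomorphism OVER the
# base onto the covering of an object of `B^cov` — from a point system and point alignment (bridge
# brick L1c-over, definition layer)

Mochizuki, *Semi-graphs of anabelioids*, Publ. RIMS **42** (2006), Def. 3.5 (i) p. 37 (the covering
`G_S → G` of `S ∈ B^cov(G)`: vertices the orbits, constituents the stabilisers, branch homomorphisms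
`k ↦ g_{b'} b_*(k) g_{b'}⁻¹`, abc-iut-L3-t2's `CovObj.coveringGraph` / `coveringHom`), Def. 2.2 (i) p. 23,
Rmk. 2.2.1 p. 24 ("`Π_{v'}` … the stabilizers") (kurims `paper:url-f33ace170ff4`).
[cite: MochizukiSemiAnbd2006, Def 3.5(i) p.37]

Brick of the (R1) bridge law L1 «finite étale ⇒ tempered» (HOME/staging/L3/L3-t3/R1-BRIDGE-SHAPES.md
§4; interface owner abc-iut-L3-t3), ENTIRELY at abc-iut-L3-t2's level (profinite presentations; no
anabelioids, no choice of paths).  Input: a morphism `p : X → P` of profinite presentations, an object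
`S ∈ B^cov(P)`, and a POINT SYSTEM `y_w ∈ S_{p w}`, `z_{e'} ∈ S_{p e'}` with
(PS1) the gluing condition of `CoveringGraphPointLift.lean` (incidences match),
(PS2) the STABILISER DICTIONARY: `p_w : Π_{X,w} → Π_{P,p w}` is injective with image `Stab(y_w)`, and
      likewise `p_{e'}` with image `Stab(z_{e'})` (Rmk. 2.2.1),
(PS3) PROFINITE POINT ALIGNMENT: along every branch `b'` of `X` at `w`, the square of `p` commutes up to
      conjugation by an element `k ∈ Π_{P,p w}` (as in `ProfiniteSemiGraph.Hom.comm`) which MOREOVER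
      carries the glued point of `z_{e(b')}` to `y_w`.
Output:

* `CovObj.pointHom` — the morphism `X → 𝒢_S` of profinite presentations over the point lift
  (`CovObj.pointLift`): on `Π_{X,w}` it is `p_w` followed by conjugation into `Stab(x_{[y_w]})`, the
  constituent of `𝒢_S` at the vertex-orbit of `y_w` (`x_ω` the chosen base point of the orbit); its
  branch squares commute up to STABILISER elements by (PS3);
* `CovObj.pointHom_isLocallyTrivial` — it is locally trivial (bijective constituents) by (PS2);
* `CovObj.pointIsoOver` — **`X ≅ 𝒢_S` OVER `P`** (`ProfiniteSemiGraph.Hom.IsoOver p S.coveringHom`, B4)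
  when moreover the point lift is bijective on vertices and edges and the base of `p` is proper.

The anabelioid-level inputs for the finite étale covering attached to `A ∈ B(ℋ)` — (PS1), (PS2) and
bijectivity: `SgAFiniteEtaleCoveringGraphIso.lean`; (PS3): the point-alignment companion — are
separate.  Definitions + bookkeeping only; nothing of the paper is asserted; no side taken on
[IUTchIII] Cor. 3.12.
-/

noncomputable section

namespace Literature.AnabelianGeometry.SemiGraphs

open CategoryTheory
open Literature.AlgebraicGeometry.Frobenioids.QuasiTemperoid.BTempConnected (hom_ρ ρ_one_apply
  ρ_mul_apply ρ_inv_apply)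

universe u

/-! ### A continuous homomorphism followed by a conjugation, corestricted to a subgroup -/

section ConjInto

variable {K Γ : Type u} [Group K] [TopologicalSpace K] [Group Γ] [TopologicalSpace Γ]
  [IsTopologicalGroup Γ]

/-- `x ↦ g q(x) g⁻¹` corestricted to a subgroup `H` containing all these values, as a continuous
homomorphism (bookkeeping for "compatible … up to inner automorphism", Def. 5.1 (iv) / §3).
[cite: MochizukiSemiAnbd2006, Def 3.5(i) p.37] -/
def conjInto (q : K →ₜ* Γ) (g : Γ) (H : Subgroup Γ) (hH : ∀ x, g * q x * g⁻¹ ∈ H) : K →ₜ* H where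
  toFun x := ⟨g * q x * g⁻¹, hH x⟩
  map_one' := Subtype.ext (by simp)
  map_mul' a b := Subtype.ext (by
    change g * q (a * b) * g⁻¹ = g * q a * g⁻¹ * (g * q b * g⁻¹)
    rw [map_mul]; group)
  continuous_toFun := by
    apply Continuous.subtype_mk
    exact (continuous_const.mul q.continuous).mul continuous_const

/-- Value of `conjInto`. [cite: MochizukiSemiAnbd2006, Def 3.5(i) p.37] -/
@[simp] theorem conjInto_apply_coe (q : K →ₜ* Γ) (g : Γ) (H : Subgroup Γ) (hH : ∀ x, g * q x * g⁻¹ ∈ H)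
    (x : K) : (conjInto q g H hH x : Γ) = g * q x * g⁻¹ := rfl

/-- `conjInto` is injective when `q` is. [cite: MochizukiSemiAnbd2006, Def 3.5(i) p.37] -/
theorem conjInto_injective (q : K →ₜ* Γ) (g : Γ) (H : Subgroup Γ) (hH : ∀ x, g * q x * g⁻¹ ∈ H)
    (hq : Function.Injective q) : Function.Injective (conjInto q g H hH) := by
  intro a b hab
  have h := congrArg Subtype.val hab
  simp only [conjInto_apply_coe, mul_left_inj, mul_right_inj] at h
  exact hq h

/-- `conjInto` is surjective onto `H` when `H = g · range(q) · g⁻¹`. [cite: MochizukiSemiAnbd2006, Def 3.5(i) p.37] -/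
theorem conjInto_surjective (q : K →ₜ* Γ) (g : Γ) (H : Subgroup Γ) (hH : ∀ x, g * q x * g⁻¹ ∈ H)
    (hq : ∀ h : Γ, h ∈ H → g⁻¹ * h * g ∈ q.toMonoidHom.range) : Function.Surjective (conjInto q g H hH) := by
  intro h
  obtain ⟨x, hx⟩ := hq h.1 h.2
  refine ⟨x, Subtype.ext ?_⟩
  rw [conjInto_apply_coe]
  change g * q.toMonoidHom x * g⁻¹ = h
  rw [hx]; group

end ConjInto

namespace ProfiniteSemiGraph

namespace CovObj

variable {X P : ProfiniteSemiGraph.{u}} (p : Hom X P) (S : CovObj P)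

/-! ### Transport bookkeeping -/

/-- Transport of points of edge fibres is compatible with the actions (transported by `castGe`).
[cite: MochizukiSemiAnbd2006, Def 3.5(i) p.37] -/
theorem castPtE_ρ {e₁ e₂ : P.graph.Edge} (h : e₁ = e₂) (g : P.Ge e₁) (t : (S.SE e₁).obj.V) :
    S.castPtE h ((S.SE e₁).obj.ρ g t) = (S.SE e₂).obj.ρ (P.castGe h g) (S.castPtE h t) := by
  subst h; rfl

/-- The chosen base point of the transported orbit is the transport of the chosen base point.
[cite: MochizukiSemiAnbd2006, Def 3.5(i) p.37] -/
theorem out_cl_castPtE {e₁ e₂ : P.graph.Edge} (h : e₁ = e₂) (t : (S.SE e₁).obj.V) :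
    Quot.out (BTemp.cl (S.SE e₂) (S.castPtE h t)) = S.castPtE h (Quot.out (BTemp.cl (S.SE e₁) t)) := by
  subst h; rfl

/-- `castGe` is multiplicative (it is an isomorphism of topological groups).
[cite: MochizukiSemiAnbd2006, Def. 2.1 p.23] -/
theorem castGe_mul {e₁ e₂ : P.graph.Edge} (h : e₁ = e₂) (a b : P.Ge e₁) :
    P.castGe h (a * b) = P.castGe h a * P.castGe h b :=
  map_mul _ a b

/-- `castGe` commutes with inversion. [cite: MochizukiSemiAnbd2006, Def. 2.1 p.23] -/
theorem castGe_inv {e₁ e₂ : P.graph.Edge} (h : e₁ = e₂) (a : P.Ge e₁) :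
    P.castGe h a⁻¹ = (P.castGe h a)⁻¹ :=
  map_inv _ a

/-- The underlying element of a constituent of `𝒢_S` transported along an equality of edges of the
covering semi-graph is the `castGe`-transport of the underlying element.
[cite: MochizukiSemiAnbd2006, Def 3.5(i) p.37] -/
theorem coe_cast_coveringGraph_Ge {ε₁ ε₂ : S.coveringSemiGraph.Edge} (h : ε₁ = ε₂)
    (m : S.coveringGraph.Ge ε₂) :
    ((h ▸ m : S.coveringGraph.Ge ε₁) : P.Ge ε₁.1) = P.castGe (congrArg Sigma.fst h).symm (m : P.Ge ε₂.1) := by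
  subst h; rfl

/-! ### The point system -/

variable (y : ∀ w : X.graph.Vertex, (S.SV (p.base.vertexMap w)).obj.V)
  (z : ∀ e' : X.graph.Edge, (S.SE (p.base.edgeMap e')).obj.V)

/-- **(PS2) The stabiliser dictionary** for a point system (Rmk. 2.2.1: "`Π_{v'}` … the
stabilizers"): the vertex and edge homomorphisms of `p` are injective with images the stabilisers of
the points. [cite: MochizukiSemiAnbd2006, Rem. 2.2.1 p.24] -/
@[mk_iff] structure StabCondition : Prop where
  /-- `p_w` is injective -/
  injective_hV : ∀ w, Function.Injective (p.hV w)
  /-- the image of `p_w` is `Stab(y_w)` -/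
  range_hV : ∀ w, (p.hV w).toMonoidHom.range = BTemp.stab (S.SV (p.base.vertexMap w)) (y w)
  /-- `p_{e'}` is injective -/
  injective_hE : ∀ e', Function.Injective (p.hE e')
  /-- the image of `p_{e'}` is `Stab(z_{e'})` -/
  range_hE : ∀ e', (p.hE e').toMonoidHom.range = BTemp.stab (S.SE (p.base.edgeMap e')) (z e')

/-- **(PS3) Profinite point alignment** for a point system: along every branch `b'` of `X` abutting to
`w`, the square of `p` at `b'` commutes up to conjugation (the shape of `ProfiniteSemiGraph.Hom.comm`)
by an element `k ∈ Π_{P, p w}` which moreover carries the glued point of `z_{e(b')}` to `y_w`.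
[cite: MochizukiSemiAnbd2006, Def 3.5(i) p.37] -/
@[mk_iff] structure PointAligned : Prop where
  /-- the aligned conjugators -/
  exists_conj : ∀ (b' : X.graph.Branch) (w : X.graph.Vertex) (h' : X.graph.abuts b' = some w),
    ∃ k : P.Gv (p.base.vertexMap w),
      (∀ x : X.Ge (X.graph.edgeOf b'),
        p.hV w (X.brHom b' w h' x) =
          k * P.brHom (p.base.branchMap b') (p.base.vertexMap w) (p.base.abuts_branchMap b' w h')
            (P.castGe (p.base.edgeOf_branchMap b').symm (p.hE (X.graph.edgeOf b') x)) * k⁻¹) ∧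
      (S.SV (p.base.vertexMap w)).obj.ρ k
          ((S.glue (p.base.branchMap b') (p.base.vertexMap w) (p.base.abuts_branchMap b' w h')).hom.hom.hom
            (S.castPtE (p.base.edgeOf_branchMap b').symm (z (X.graph.edgeOf b')))) = y w

variable {p S y z}

/-! ### The conjugating elements into the chosen base points -/

/-- An element of `Π_{P, p w}` carrying `y_w` to the chosen base point of its orbit.
[cite: MochizukiSemiAnbd2006, Def 3.5(i) p.37] -/
theorem exists_ρ_eq_out_V (w : X.graph.Vertex) :
    ∃ g : P.Gv (p.base.vertexMap w), (S.SV _).obj.ρ g (y w) = Quot.out (BTemp.cl (S.SV _) (y w)) :=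
  (BTemp.cl_eq_cl_iff _ _ _).mp (Quot.out_eq (BTemp.cl (S.SV _) (y w))).symm

/-- An element of `Π_{P, p e'}` carrying `z_{e'}` to the chosen base point of its orbit.
[cite: MochizukiSemiAnbd2006, Def 3.5(i) p.37] -/
theorem exists_ρ_eq_out_E (e' : X.graph.Edge) :
    ∃ g : P.Ge (p.base.edgeMap e'), (S.SE _).obj.ρ g (z e') = Quot.out (BTemp.cl (S.SE _) (z e')) :=
  (BTemp.cl_eq_cl_iff _ _ _).mp (Quot.out_eq (BTemp.cl (S.SE _) (z e'))).symm

variable (p S y z)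

/-- CHOSEN `g_w ∈ Π_{P,p w}` with `g_w · y_w = x_{[y_w]}`. [cite: MochizukiSemiAnbd2006, Def 3.5(i) p.37] -/
def gV (w : X.graph.Vertex) : P.Gv (p.base.vertexMap w) := Classical.choose (exists_ρ_eq_out_V (S := S) (y := y) w)

/-- Defining property of `gV`. [cite: MochizukiSemiAnbd2006, Def 3.5(i) p.37] -/
theorem gV_spec (w : X.graph.Vertex) :
    (S.SV _).obj.ρ (gV p S y w) (y w) = Quot.out (BTemp.cl (S.SV _) (y w)) :=
  Classical.choose_spec (exists_ρ_eq_out_V (S := S) (y := y) w)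

/-- CHOSEN `g_{e'} ∈ Π_{P,p e'}` with `g_{e'} · z_{e'} = x_{[z_{e'}]}`. [cite: MochizukiSemiAnbd2006, Def 3.5(i) p.37] -/
def gE (e' : X.graph.Edge) : P.Ge (p.base.edgeMap e') := Classical.choose (exists_ρ_eq_out_E (S := S) (z := z) e')

/-- Defining property of `gE`. [cite: MochizukiSemiAnbd2006, Def 3.5(i) p.37] -/
theorem gE_spec (e' : X.graph.Edge) :
    (S.SE _).obj.ρ (gE p S z e') (z e') = Quot.out (BTemp.cl (S.SE _) (z e')) :=
  Classical.choose_spec (exists_ρ_eq_out_E (S := S) (z := z) e')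

/-- A conjugate of a stabiliser element stabilises the translated point.
[cite: MochizukiSemiAnbd2006, Def 3.5(i) p.37] -/
theorem conj_mem_stab {Γ : Type u} [Group Γ] [TopologicalSpace Γ] (T : BTemp Γ) {s o : T.obj.V}
    (g m : Γ) (hg : T.obj.ρ g s = o) (hm : m ∈ BTemp.stab T s) : g * m * g⁻¹ ∈ BTemp.stab T o := by
  change T.obj.ρ (g * m * g⁻¹) o = o
  rw [ρ_mul_apply, ρ_mul_apply, ← hg, ρ_inv_apply, show T.obj.ρ m s = s from hm]

/-- Conversely. [cite: MochizukiSemiAnbd2006, Def 3.5(i) p.37] -/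
theorem conj_inv_mem_stab {Γ : Type u} [Group Γ] [TopologicalSpace Γ] (T : BTemp Γ) {s o : T.obj.V}
    (g m : Γ) (hg : T.obj.ρ g s = o) (hm : m ∈ BTemp.stab T o) : g⁻¹ * m * g ∈ BTemp.stab T s := by
  have hg' : T.obj.ρ g⁻¹ o = s := by rw [← hg, ρ_inv_apply]
  have := conj_mem_stab T g⁻¹ m hg' hm
  rwa [inv_inv] at this

variable (hglue : S.GlueCondition p.base y z) (hS : StabCondition p S y z)

/-! ### The constituent homomorphisms -/

/-- The vertex homomorphism `Π_{X,w} → Stab(x_{[y_w]}) = Π_{𝒢_S, (p w, [y_w])}`: `p_w` followed by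
conjugation by `g_w`. [cite: MochizukiSemiAnbd2006, Def 3.5(i) p.37] -/
def pointHV (w : X.graph.Vertex) :
    X.Gv w →ₜ* BTemp.stab (S.SV (p.base.vertexMap w)) (Quot.out (BTemp.cl (S.SV _) (y w))) :=
  conjInto (p.hV w) (gV p S y w) _ fun x =>
    conj_mem_stab _ _ _ (gV_spec p S y w) (by rw [← hS.range_hV w]; exact ⟨x, rfl⟩)

/-- Value of the vertex homomorphism. [cite: MochizukiSemiAnbd2006, Def 3.5(i) p.37] -/
@[simp] theorem pointHV_apply_coe (w : X.graph.Vertex) (x : X.Gv w) :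
    (pointHV p S y z hS w x : P.Gv (p.base.vertexMap w)) = gV p S y w * p.hV w x * (gV p S y w)⁻¹ := rfl

/-- The edge homomorphism `Π_{X,e'} → Stab(x_{[z_{e'}]}) = Π_{𝒢_S, (p e', [z_{e'}])}`.
[cite: MochizukiSemiAnbd2006, Def 3.5(i) p.37] -/
def pointHE (e' : X.graph.Edge) :
    X.Ge e' →ₜ* BTemp.stab (S.SE (p.base.edgeMap e')) (Quot.out (BTemp.cl (S.SE _) (z e'))) :=
  conjInto (p.hE e') (gE p S z e') _ fun x =>
    conj_mem_stab _ _ _ (gE_spec p S z e') (by rw [← hS.range_hE e']; exact ⟨x, rfl⟩)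

/-- Value of the edge homomorphism. [cite: MochizukiSemiAnbd2006, Def 3.5(i) p.37] -/
@[simp] theorem pointHE_apply_coe (e' : X.graph.Edge) (x : X.Ge e') :
    (pointHE p S y z hS e' x : P.Ge (p.base.edgeMap e')) = gE p S z e' * p.hE e' x * (gE p S z e')⁻¹ := rfl

/-- The vertex homomorphisms are bijective (injective as `p_w` is; onto `Stab(x_{[y_w]}) =
g_w Stab(y_w) g_w⁻¹ = g_w p_w(Π_{X,w}) g_w⁻¹`). [cite: MochizukiSemiAnbd2006, Rem. 2.2.1 p.24] -/
theorem pointHV_bijective (w : X.graph.Vertex) : Function.Bijective (pointHV p S y z hS w) := by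
  refine ⟨conjInto_injective _ _ _ _ (hS.injective_hV w), conjInto_surjective _ _ _ _ fun h hh => ?_⟩
  rw [hS.range_hV w]
  exact conj_inv_mem_stab _ _ _ (gV_spec p S y w) hh

/-- The edge homomorphisms are bijective. [cite: MochizukiSemiAnbd2006, Rem. 2.2.1 p.24] -/
theorem pointHE_bijective (e' : X.graph.Edge) : Function.Bijective (pointHE p S y z hS e') := by
  refine ⟨conjInto_injective _ _ _ _ (hS.injective_hE e'), conjInto_surjective _ _ _ _ fun h hh => ?_⟩
  rw [hS.range_hE e']
  exact conj_inv_mem_stab _ _ _ (gE_spec p S z e') hh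

/-! ### The branch squares: commutation up to STABILISER elements -/

/-- The branch homomorphism of `𝒢_S` on underlying elements: `m ↦ c · b_*(m) · c⁻¹`, `c` the chosen
conjugator. [cite: MochizukiSemiAnbd2006, Def 3.5(i) p.37] -/
theorem coe_coveringGraph_brHom {β : S.coveringSemiGraph.Branch} {ν : S.coveringSemiGraph.Vertex}
    (h : S.coveringSemiGraph.abuts β = some ν) (m : S.coveringGraph.Ge (S.coveringSemiGraph.edgeOf β)) :
    ((S.coveringGraph.brHom β ν h m : S.coveringGraph.Gv ν) : P.Gv ν.1) =
      S.conjugator h * P.brHom β.1 ν.1 (S.abuts_of_coveringAbuts h) (m : P.Ge (P.graph.edgeOf β.1)) *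
        (S.conjugator h)⁻¹ :=
  rfl

/-- **The branch square at `b'` commutes up to an element of the STABILISER `Stab(x_{[y_w]})`** (the
constituent of `𝒢_S`): with `k` the aligned conjugator of (PS3), `c` the chosen conjugator of `𝒢_S` at
the branch-orbit and `g_w`, `g_{e'}` the chosen translations, the element
`γ := g_w k (c · b_*(g_{e'}))⁻¹` fixes `x_{[y_w]}` (it carries it through
`x_{[y_w]} ↦ glued(x_{[z]}) ↦ glued(z) ↦ y_w ↦ x_{[y_w]}`) and conjugates the one composite into the
other. [cite: MochizukiSemiAnbd2006, Def 3.5(i) p.37] -/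
theorem pointHom_comm (hPA : PointAligned p S y z) (b' : X.graph.Branch) (w : X.graph.Vertex)
    (h' : X.graph.abuts b' = some w) :
    ∃ γ : S.coveringGraph.Gv ((S.pointLift p.base y z hglue).vertexMap w),
      ∀ x : X.Ge (X.graph.edgeOf b'),
        pointHV p S y z hS w (X.brHom b' w h' x) =
          γ * S.coveringGraph.brHom ((S.pointLift p.base y z hglue).branchMap b')
              ((S.pointLift p.base y z hglue).vertexMap w)
              ((S.pointLift p.base y z hglue).abuts_branchMap b' w h')
              ((S.pointLift p.base y z hglue).edgeOf_branchMap b' ▸ pointHE p S y z hS (X.graph.edgeOf b') x) *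
            γ⁻¹ := by
  obtain ⟨k, hk, hky⟩ := hPA.exists_conj b' w h'
  have hab : S.coveringSemiGraph.abuts ((S.pointLift p.base y z hglue).branchMap b') =
      some ((S.pointLift p.base y z hglue).vertexMap w) :=
    (S.pointLift p.base y z hglue).abuts_branchMap b' w h'
  have hcspec := S.conjugator_spec hab
  -- `ε := c · b_*(g_{e'})` carries `glued(z̃)` to `x_{[y_w]}`
  have hεz : (S.SV (p.base.vertexMap w)).obj.ρ
      (S.conjugator hab * P.brHom (p.base.branchMap b') (p.base.vertexMap w)
        (p.base.abuts_branchMap b' w h')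
        (P.castGe (p.base.edgeOf_branchMap b').symm (gE p S z (X.graph.edgeOf b'))))
      ((S.glue (p.base.branchMap b') (p.base.vertexMap w) (p.base.abuts_branchMap b' w h')).hom.hom.hom
        (S.castPtE (p.base.edgeOf_branchMap b').symm (z (X.graph.edgeOf b')))) =
      Quot.out (BTemp.cl (S.SV (p.base.vertexMap w)) (y w)) := by
    rw [ρ_mul_apply, ← glue_ρ, ← castPtE_ρ, gE_spec, ← out_cl_castPtE]
    exact hcspec
  -- the stabiliser element
  have hγ : gV p S y w * k *
      (S.conjugator hab * P.brHom (p.base.branchMap b') (p.base.vertexMap w)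
        (p.base.abuts_branchMap b' w h')
        (P.castGe (p.base.edgeOf_branchMap b').symm (gE p S z (X.graph.edgeOf b'))))⁻¹ ∈
      BTemp.stab (S.SV (p.base.vertexMap w)) (Quot.out (BTemp.cl (S.SV (p.base.vertexMap w)) (y w))) := by
    change (S.SV (p.base.vertexMap w)).obj.ρ _ _ = _
    rw [ρ_mul_apply, ρ_mul_apply]
    nth_rewrite 1 [← hεz]
    rw [ρ_inv_apply, hky, gV_spec]
  refine ⟨⟨_, hγ⟩, fun x => Subtype.ext ?_⟩
  -- compare underlying elements of `Π_{P, p w}`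
  rw [pointHV_apply_coe, hk x, Subgroup.coe_mul, Subgroup.coe_mul, Subgroup.coe_inv,
    coe_coveringGraph_brHom, S.coe_cast_coveringGraph_Ge ((S.pointLift p.base y z hglue).edgeOf_branchMap b'),
    pointHE_apply_coe]
  change gV p S y w * (k * P.brHom (p.base.branchMap b') (p.base.vertexMap w)
      (p.base.abuts_branchMap b' w h')
      (P.castGe (p.base.edgeOf_branchMap b').symm (p.hE (X.graph.edgeOf b') x)) * k⁻¹) * (gV p S y w)⁻¹ =
    gV p S y w * k *
        (S.conjugator hab * P.brHom (p.base.branchMap b') (p.base.vertexMap w)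
          (p.base.abuts_branchMap b' w h')
          (P.castGe (p.base.edgeOf_branchMap b').symm (gE p S z (X.graph.edgeOf b'))))⁻¹ *
      (S.conjugator hab * P.brHom (p.base.branchMap b') (p.base.vertexMap w)
          (p.base.abuts_branchMap b' w h')
          (P.castGe (p.base.edgeOf_branchMap b').symm
            (gE p S z (X.graph.edgeOf b') * p.hE (X.graph.edgeOf b') x * (gE p S z (X.graph.edgeOf b'))⁻¹)) *
        (S.conjugator hab)⁻¹) *
      (gV p S y w * k *
        (S.conjugator hab * P.brHom (p.base.branchMap b') (p.base.vertexMap w)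
          (p.base.abuts_branchMap b' w h')
          (P.castGe (p.base.edgeOf_branchMap b').symm (gE p S z (X.graph.edgeOf b'))))⁻¹)⁻¹
  rw [castGe_mul, castGe_mul, castGe_inv, map_mul, map_mul, map_inv]
  group

/-! ### The morphism of profinite presentations and the isomorphism over the base -/

/-- **The morphism `X → 𝒢_S` of profinite presentations** over the point lift: constituents `p_w`,
`p_{e'}` followed by the conjugations into the stabilisers of the chosen base points; branch squares
by `pointHom_comm`. [cite: MochizukiSemiAnbd2006, Def 3.5(i) p.37] -/
def pointHom (hPA : PointAligned p S y z) : Hom X S.coveringGraph where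
  base := S.pointLift p.base y z hglue
  hV w := pointHV p S y z hS w
  hE e' := pointHE p S y z hS e'
  comm b' w h' := pointHom_comm p S y z hglue hS hPA b' w h'

/-- The morphism `X → 𝒢_S` is locally trivial (bijective constituents).
[cite: MochizukiSemiAnbd2006, Def 2.2(ii) p.24] -/
theorem pointHom_isLocallyTrivial (hPA : PointAligned p S y z) :
    (pointHom p S y z hglue hS hPA).IsLocallyTrivial :=
  ⟨fun w => pointHV_bijective p S y z hS w, fun e' => pointHE_bijective p S y z hS e'⟩

/-- **`X ≅ 𝒢_S` over `P`**: for a point system with the gluing condition, the stabiliser dictionary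
and profinite point alignment, whose lift is bijective on vertices and edges over a proper base, the
morphism `pointHom` is an isomorphism of profinite presentations OVER `P` between `p : X → P` and the
covering `𝒢_S → P` of `S` (B4 `Hom.IsoOver`): compatible with the structure morphisms up to the inner
automorphisms `g_w`, `g_{e'}`. [cite: MochizukiSemiAnbd2006, Def 3.5(i) p.37] -/
def pointIsoOver (hPA : PointAligned p S y z) (hf : SemiGraph.IsProper p.base)
    (hv : Function.Bijective (S.pointLift p.base y z hglue).vertexMap)
    (he : Function.Bijective (S.pointLift p.base y z hglue).edgeMap) :
    Hom.IsoOver p S.coveringHom where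
  iso := pointHom p S y z hglue hS hPA
  isIso_base := S.isIso_pointLift p.base y z hglue hf hv he
  isLocallyTrivial := pointHom_isLocallyTrivial p S y z hglue hS hPA
  base_comm := S.pointLift_comp_base p.base y z hglue
  hV_comm w := ⟨gV p S y w, fun _ => rfl⟩
  hE_comm e' := ⟨gE p S z e', fun _ => rfl⟩

end CovObj

end ProfiniteSemiGraph

end Literature.AnabelianGeometry.SemiGraphs

end
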